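import Summits.FinalStateConjecture.FinalStateConjecture.Theorems.ClusterCompletenessLinearToNonlinearCaptureRecurrentChartsDefs
import HarnessLib

/-!
# Route ClusterCompleteness · crux `LinearToNonlinearCapture` — LAB-SYNCHRONOUS THICK recurrence
# (`RecurrentChartsSync`, `RecursSync`; posited-object vocabulary, D-0016 `<Route>Defs` convention)

Vocabulary of line `thrift-handoff` (skeleton v3.1, lead c15) of the crux
`ClusterCompleteness.LinearToNonlinearCapture` (stmt-FinalStateConjecture-14526).

`RecursO k 𝒟` (…OmegaLimitMultiKerrBirthDefs; = the hypothesis of the route target X at rev 21)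
certifies, in its recurrence clause C13, the flat chart on the LAB-time slab `{x⁰ = τ}` and hole `i`
on the REST-time slab `{(Λᵢ⁻¹(x − cᵢ))⁰ = τ}` at ONE parameter `τ`, at single instants. Along hole
`i`'s world-line `cᵢ + sΛᵢe₀` the rest time advances by `s` and the lab time by `γᵢ s`,
`γᵢ = (Λᵢe₀)⁰` (`poincareInv_add_smul`, KerrSchildChartCovariance), so the certified epochs of the
holes (`cᵢ⁰ + γᵢτ`) and of the flat region (`τ`) drift apart (interface defect D1 of lead c10,
2026-08-16). A restart LAYER at one lab time — the object the thrift hand-over manufactures — needs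
the charts certified SIMULTANEOUSLY in lab time, and (for the interior collar of the layer and the
short-time evolution around the launch) on a THICK window of lab times rather than at an instant.
This file names that hypothesis, over the SAME eleven chart objects and with clauses C1–C12 of
`RecurrentCharts` byte-identical:

* `RecurrentChartsSync k 𝒟 O N M a mo τ₀ Ψ ρ R U₀ Ψ₀` — C1–C12 verbatim, and C13ˢ: for every radius
  `R'`, window width `W` and `ε > 0`, frequently in LAB time `t`, for EVERY lab time `s ∈ [t − W, t]`
  the flat chart is `ε`-flat in `Cᵏ` on `{x⁰ = s}` and every hole chart `Ψᵢ` is `ε`-Kerr in `Cᵏ` on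
  its truncated rest slab of the SYNCHRONISED parameter `σᵢ(s) = (s − cᵢ⁰)/γᵢ` (the rest slab
  through the point of its world-line whose lab time is `s`; `γᵢ > 0` by C11, so the quotient is
  honest), truncated at the radius `max R' (Rᵢ(σᵢ(s)))` — out to the hypothesis's OWN exhaustion
  radius `Rᵢ` (C5/C10/C12), so that the `Cᵏ`-certified near zone reaches the flat domain (whose
  slab is certified whole) instead of stopping at a fixed `R'` inside the sublinearly growing tube
  (the `C⁰`-only annulus `{R' < rᵢ < ρᵢ}` noted by lead c14, O2) — with future-directed transported
  Kerr time vectors there. Three consumer-side repairs of C13 in one clause: SYNCHRONISATION (D1),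
  THICKNESS (windows, which feed the interior collar `{Mᵢ < rᵢ ≤ r₊}` of a restart layer through
  the red-shift bookkeeping of horizon crossings during the window), RADIAL OVERLAP (O2);
* `RecursSync k 𝒟` — the packed form `∃ …, RecurrentChartsSync k 𝒟 …`, `recursSync_iff` (`Iff.rfl`);
* `RecurrentChartsSync.toBase`-type accessors are NOT repeated (project C1–C12 by `.1`, `.2.1`, … or
  restate as needed); `RecurrentChartsSync.anti` (antitone in `k`), `RecurrentChartsSync.recur`
  (the clause C13ˢ).

Consistency (not proved here, recorded for reviewers): charts that CONVERGE in `Cᵏ` at all late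
times satisfy C13ˢ for every `W` (eventually ⇒ frequently on windows; certificate
`syncClause_of_tendsto` in the lead's evidence file `SyncOfRest.lean`); for labels at rest with zero
time offset (`Λᵢe₀ = e₀`, `cᵢ⁰ = 0`) and `W = 0` the clause is C13 of `RecursO` (certificate
`syncRecurrence_of_recursO_of_atRest`, ibid.). Everything is a definition over existing declarations
or a projection; no new mathematics. References: Dafermos–Luk arXiv:1710.01722 §1.2.1 (final-state
charts); O'Neill 1983 Ch. 9 p. 236 (Poincaré maps).
-/

-- every `Summit.FinalStateConjecture.FinalStateConjecture.…` name repeats the summit = sub-problem segment (D-0017 layout)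
set_option linter.dupNamespace false

noncomputable section

open scoped Manifold ContDiff Topology ENNReal
open Set Filter Function TopologicalSpace

namespace Summit.FinalStateConjecture.FinalStateConjecture.Theorems.ClusterCompleteness

open Literature.Geometry.Lorentzian

variable {X : Type} [TopologicalSpace X] [ChartedSpace E3 X] [IsManifold (𝓡 3) ∞ X]
  [ConnectedSpace X] {D : InitialDataSet (𝓡 3) X}

/-- **Lab-synchronous thick recurrence of recurrent chart data, objects exposed.** Clauses C1–C12 of
`RecurrentCharts` VERBATIM (sub-extremal labels, late hole charts and late flat chart into `O`,
sublinear tubes, honest radii, tube complement inside `U₀`, separation at every radius,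
`O = exteriorOf charted`, rays stay in `closure O`, exhaustion at every chart time, orthochronous
motions / future-directed flat chart time, the uniform `C⁰` anchor `1/4`), and C13ˢ: `Cᵏ`
`ε`-recurrence at every radius, on WINDOWS of every width, SIMULTANEOUSLY in lab time — hole `i` being
read on its rest slab of parameter `(s − cᵢ⁰)/γᵢ`, `cᵢ = (mo i).2`, `γᵢ = ((mo i).1 e₀)⁰`.
[cite: DafermosLuk2017, §1.2.1] -/
def RecurrentChartsSync (k : ℕ) (𝒟 : VacuumCauchyDevelopment D) (O : Set 𝒟.carrier) (N : ℕ) (M a : Fin N → ℝ) (mo : Fin N → lorentzGroup × E4) (τ₀ : ℝ) (Ψ : ∀ i, boostedKerrExterior (mo i).1 (mo i).2 (M i) (a i) → 𝒟.carrier) (ρ R : Fin N → ℝ → ℝ) (U₀ : Opens E4) (Ψ₀ : U₀ → 𝒟.carrier) : Prop :=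
  (∀ i, Kerr.IsSubextremal (M i) (a i)) ∧ (∀ i, 𝒟.toSpacetime.IsLateChart (boostedKerrBackground
  (mo i).1 (mo i).2 (M i) (a i)) O τ₀ (Ψ i)) ∧ 𝒟.toSpacetime.IsLateChart (Minkowski.backgroundOn
  U₀) O τ₀ Ψ₀ ∧ (∀ i, Tendsto (fun t ↦ ρ i t / t) atTop (𝓝 0)) ∧ (∀ i, Tendsto (R i) atTop atTop ∧
  ∀ τ, max (Kerr.rPlus (M i) (a i)) 0 + 1 ≤ R i τ) ∧ {x : E4 | τ₀ < x 0 ∧ ∀ i, ρ i (x 0) <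
  Kerr.radius (a i) (poincareInv (mo i).1 (mo i).2 x)} ⊆ (U₀ : Set E4) ∧ (∀ R' : ℝ, ∃ τ₁ : ℝ,
  Pairwise (Function.onFun Disjoint fun i ↦ Ψ i '' (boostedKerrBackground (mo i).1 (mo i).2 (M i)
  (a i)).truncLateRegion τ₁ R')) ∧ O = Summit.FinalStateConjecture.exteriorOf 𝒟.toCauchyDevelopment
  ((⋃ i, Ψ i '' (boostedKerrBackground (mo i).1 (mo i).2 (M i) (a i)).lateRegion τ₀) ∪ Ψ₀ ''
  (Minkowski.backgroundOn U₀).lateRegion τ₀) ∧ Summit.FinalStateConjecture.RaysStayInClosure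
  𝒟.toCauchyDevelopment O ∧ (∀ τ₁ : ℝ, τ₀ < τ₁ → O \ (Ψ₀ '' (Minkowski.backgroundOn U₀).lateRegion
  τ₁ ∪ ⋃ i, Ψ i '' {x | τ₁ < (boostedKerrBackground (mo i).1 (mo i).2 (M i) (a i)).time x.1 ∧
  (boostedKerrBackground (mo i).1 (mo i).2 (M i) (a i)).radius x.1 ≤ R i ((boostedKerrBackground
  (mo i).1 (mo i).2 (M i) (a i)).time x.1)}) ⊆ 𝒟.metric.causalPast 𝒟.timeOrientation (Ψ₀ ''
  (Minkowski.backgroundOn U₀).timeSlab τ₁ ∪ ⋃ i, Ψ i '' (boostedKerrBackground (mo i).1 (mo i).2 (M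
  i) (a i)).truncTimeSlab (R i τ₁) τ₁)) ∧ ((∀ i, Summit.FinalStateConjecture.IsOrthochronous (mo
  i).1) ∧ ∀ τ : ℝ, τ₀ < τ → ∀ x ∈ (Minkowski.backgroundOn U₀).timeSlab τ,
  𝒟.toSpacetime.timeOrientation.IsFutureDirected (mfderiv 𝓘(ℝ, E4) (𝓡 4) Ψ₀ x (E4.basisVector 0)))
  ∧ (∀ τ : ℝ, τ₀ < τ → 𝒟.toSpacetime.deviationCk (Minkowski.backgroundOn U₀) Ψ₀ 0 τ ≤
  ENNReal.ofReal (1 / 4) ∧ ∀ i, 𝒟.toSpacetime.truncDeviationCk (boostedKerrBackground (mo i).1 (mo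
  i).2 (M i) (a i)) (Ψ i) 0 (R i τ) τ ≤ ENNReal.ofReal (1 / 4)) ∧
    ∀ R' : ℝ, ∀ W : ℝ, ∀ ε : ℝ, 0 < ε → ∃ᶠ t in atTop, ∀ s ∈ Set.Icc (t - W) t,
    𝒟.toSpacetime.deviationCk (Minkowski.backgroundOn U₀) Ψ₀ k s ≤ ENNReal.ofReal ε ∧ ∀ i,
    𝒟.toSpacetime.truncDeviationCk (boostedKerrBackground (mo i).1 (mo i).2 (M i) (a i)) (Ψ i) k (max R' (R i ((s - (mo i).2 0) / (((mo i).1 : E4 ≃L[ℝ] E4) (E4.basisVector 0) 0)))) ((s - (mo i).2 0) / (((mo i).1 : E4 ≃L[ℝ] E4) (E4.basisVector 0) 0)) ≤ ENNReal.ofReal ε ∧ ∀ x ∈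
    (boostedKerrBackground (mo i).1 (mo i).2 (M i) (a i)).truncTimeSlab (max R' (R i ((s - (mo i).2 0) / (((mo i).1 : E4 ≃L[ℝ] E4) (E4.basisVector 0) 0)))) ((s - (mo i).2 0) / (((mo i).1 : E4 ≃L[ℝ] E4) (E4.basisVector 0) 0)),
    𝒟.toSpacetime.timeOrientation.IsFutureDirected (mfderiv 𝓘(ℝ, E4) (𝓡 4) (Ψ i) x (((mo i).1 : E4
    ≃L[ℝ] E4) (Kerr.timeVector (M i) (a i) (poincareInv (mo i).1 (mo i).2 (x : E4)))))

/-- **Recurs lab-synchronously and thickly at order `k`** (one development): the packed form.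
[cite: DafermosLuk2017, §1.2.1] -/
def RecursSync (k : ℕ) (𝒟 : VacuumCauchyDevelopment D) : Prop :=
  ∃ (O : Set 𝒟.carrier) (N : ℕ) (M a : Fin N → ℝ) (mo : Fin N → lorentzGroup × E4) (τ₀ : ℝ) (Ψ : ∀ i, boostedKerrExterior (mo i).1 (mo i).2 (M i) (a i) → 𝒟.carrier) (ρ R : Fin N → ℝ → ℝ) (U₀ : Opens E4) (Ψ₀ : U₀ → 𝒟.carrier),
    RecurrentChartsSync k 𝒟 O N M a mo τ₀ Ψ ρ R U₀ Ψ₀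

/-- **Read-back (`Iff.rfl`):** `RecursSync k 𝒟` is the existence of lab-synchronously recurrent chart
data. [cite: DafermosLuk2017, §1.2.1] -/
theorem recursSync_iff_exists_recurrentChartsSync : ∀ {X : Type} [TopologicalSpace X] [ChartedSpace E3 X] [IsManifold (𝓡 3) ∞ X] [ConnectedSpace X] {D : InitialDataSet (𝓡 3) X} {k : ℕ} {𝒟 : VacuumCauchyDevelopment D}, RecursSync k 𝒟 ↔ ∃ (O : Set 𝒟.carrier) (N : ℕ) (M a : Fin N → ℝ) (mo : Fin N → lorentzGroup × E4) (τ₀ : ℝ) (Ψ : ∀ i, boostedKerrExterior (mo i).1 (mo i).2 (M i) (a i) → 𝒟.carrier) (ρ R : Fin N → ℝ → ℝ) (U₀ : Opens E4) (Ψ₀ : U₀ → 𝒟.carrier), RecurrentChartsSync k 𝒟 O N M a mo τ₀ Ψ ρ R U₀ Ψ₀ := by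
  intros; exact Iff.rfl

namespace RecurrentChartsSync

variable {k : ℕ} {𝒟 : VacuumCauchyDevelopment D} {O : Set 𝒟.carrier} {N : ℕ} {M a : Fin N → ℝ}
  {mo : Fin N → lorentzGroup × E4} {τ₀ : ℝ}
  {Ψ : ∀ i, boostedKerrExterior (mo i).1 (mo i).2 (M i) (a i) → 𝒟.carrier} {ρ R : Fin N → ℝ → ℝ}
  {U₀ : Opens E4} {Ψ₀ : U₀ → 𝒟.carrier}

/-- The packed form. [cite: DafermosLuk2017, §1.2.1] -/
theorem recursSync (h : RecurrentChartsSync k 𝒟 O N M a mo τ₀ Ψ ρ R U₀ Ψ₀) : RecursSync k 𝒟 :=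
  ⟨O, N, M, a, mo, τ₀, Ψ, ρ, R, U₀, Ψ₀, h⟩

/-- C1–C12 are those of `RecurrentCharts` at order `0` MINUS its recurrence clause: precisely, the
synchronous data satisfy every clause of `RecurrentCharts 0` except C13, so we expose the two that
capture lines use most — C1 (sub-extremal labels) and C11 (orientation; it makes `γᵢ > 0`).
[cite: DafermosLuk2017, §1.2.1] -/
theorem subextremal (h : RecurrentChartsSync k 𝒟 O N M a mo τ₀ Ψ ρ R U₀ Ψ₀) (i : Fin N) :
    Kerr.IsSubextremal (M i) (a i) :=
  h.1 i

/-- C11: orthochronous motions and future-directed flat chart time. [cite: DafermosLuk2017, §1.2.1] -/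
theorem oriented (h : RecurrentChartsSync k 𝒟 O N M a mo τ₀ Ψ ρ R U₀ Ψ₀) :
    (∀ i, Summit.FinalStateConjecture.IsOrthochronous (mo i).1) ∧ ∀ τ : ℝ, τ₀ < τ → ∀ x ∈
      (Minkowski.backgroundOn U₀).timeSlab τ, 𝒟.toSpacetime.timeOrientation.IsFutureDirected
      (mfderiv 𝓘(ℝ, E4) (𝓡 4) Ψ₀ x (E4.basisVector 0)) :=
  h.2.2.2.2.2.2.2.2.2.2.1

/-- The Lorentz factor `γᵢ = (Λᵢe₀)⁰` of every hole is positive (from C11), so the synchronised rest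
parameter `(s − cᵢ⁰)/γᵢ` is an honest quotient. [cite: DafermosLuk2017, §1.2.1] -/
theorem gamma_pos (h : RecurrentChartsSync k 𝒟 O N M a mo τ₀ Ψ ρ R U₀ Ψ₀) (i : Fin N) :
    0 < ((mo i).1 : E4 ≃L[ℝ] E4) (E4.basisVector 0) 0 :=
  h.oriented.1 i

/-- C13ˢ: lab-synchronous thick `Cᵏ` recurrence. [cite: DafermosLuk2017, §1.2.1] -/
theorem recur (h : RecurrentChartsSync k 𝒟 O N M a mo τ₀ Ψ ρ R U₀ Ψ₀) (R' W : ℝ) {ε : ℝ}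
    (hε : 0 < ε) :
    ∃ᶠ t in atTop, ∀ s ∈ Set.Icc (t - W) t, 𝒟.toSpacetime.deviationCk (Minkowski.backgroundOn U₀)
    Ψ₀ k s ≤ ENNReal.ofReal ε ∧ ∀ i, 𝒟.toSpacetime.truncDeviationCk (boostedKerrBackground (mo i).1
    (mo i).2 (M i) (a i)) (Ψ i) k (max R' (R i ((s - (mo i).2 0) / (((mo i).1 : E4 ≃L[ℝ] E4) (E4.basisVector 0) 0)))) ((s - (mo i).2 0) / (((mo i).1 : E4 ≃L[ℝ] E4) (E4.basisVector 0) 0)) ≤ ENNReal.ofReal ε ∧ ∀ x ∈ (boostedKerrBackground (mo i).1 (mo i).2 (M i) (a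
    i)).truncTimeSlab (max R' (R i ((s - (mo i).2 0) / (((mo i).1 : E4 ≃L[ℝ] E4) (E4.basisVector 0) 0)))) ((s - (mo i).2 0) / (((mo i).1 : E4 ≃L[ℝ] E4) (E4.basisVector 0) 0)),
    𝒟.toSpacetime.timeOrientation.IsFutureDirected (mfderiv 𝓘(ℝ, E4) (𝓡 4) (Ψ i) x (((mo i).1 : E4
    ≃L[ℝ] E4) (Kerr.timeVector (M i) (a i) (poincareInv (mo i).1 (mo i).2 (x : E4))))) :=
  h.2.2.2.2.2.2.2.2.2.2.2.2 R' W ε hε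

/-- Antitone in the order (same charts). [cite: DafermosLuk2017, §1.2.1] -/
theorem anti {k' : ℕ} (hk : k' ≤ k) (h : RecurrentChartsSync k 𝒟 O N M a mo τ₀ Ψ ρ R U₀ Ψ₀) :
    RecurrentChartsSync k' 𝒟 O N M a mo τ₀ Ψ ρ R U₀ Ψ₀ := by
  obtain ⟨h1, h2, h3, h4, h5, h6, h7, h8, h9, h10, h11, h12, h13⟩ := h
  refine ⟨h1, h2, h3, h4, h5, h6, h7, h8, h9, h10, h11, h12, fun R' W ε hε ↦ ?_⟩
  refine (h13 R' W ε hε).mono fun t ht s hs ↦ ⟨?_, fun i ↦ ⟨?_, ((ht s hs).2 i).2⟩⟩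
  · exact (𝒟.toSpacetime.deviationCk_mono (Minkowski.backgroundOn U₀) Ψ₀ hk s).trans (ht s hs).1
  · exact (supCkENorm_mono_right _ hk _).trans ((ht s hs).2 i).1

/-- Monotone in the window: thick recurrence on windows of every width gives, with `W = 0`, the
INSTANT lab-synchronous clause at the epoch itself. [cite: DafermosLuk2017, §1.2.1] -/
theorem recur_instant (h : RecurrentChartsSync k 𝒟 O N M a mo τ₀ Ψ ρ R U₀ Ψ₀) (R' : ℝ) {ε : ℝ}
    (hε : 0 < ε) :
    ∃ᶠ t in atTop, 𝒟.toSpacetime.deviationCk (Minkowski.backgroundOn U₀) Ψ₀ k t ≤ ENNReal.ofReal ε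
    ∧ ∀ i, 𝒟.toSpacetime.truncDeviationCk (boostedKerrBackground (mo i).1 (mo i).2 (M i) (a i)) (Ψ i) k (max R' (R i ((t - (mo i).2 0) / (((mo i).1 : E4 ≃L[ℝ] E4) (E4.basisVector 0) 0)))) ((t - (mo i).2 0) / (((mo i).1 : E4 ≃L[ℝ] E4) (E4.basisVector 0) 0)) ≤ ENNReal.ofReal ε
    ∧ ∀ x ∈ (boostedKerrBackground (mo i).1 (mo i).2 (M i) (a i)).truncTimeSlab (max R' (R i ((t - (mo i).2 0) / (((mo i).1 : E4 ≃L[ℝ] E4) (E4.basisVector 0) 0)))) ((t - (mo i).2 0) / (((mo i).1 : E4 ≃L[ℝ] E4) (E4.basisVector 0) 0)),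
    𝒟.toSpacetime.timeOrientation.IsFutureDirected (mfderiv 𝓘(ℝ, E4) (𝓡 4) (Ψ i) x (((mo i).1 : E4
    ≃L[ℝ] E4) (Kerr.timeVector (M i) (a i) (poincareInv (mo i).1 (mo i).2 (x : E4))))) := by
  refine (h.recur R' 0 hε).mono fun t ht ↦ ?_
  exact ht t ⟨by simp, le_rfl⟩

end RecurrentChartsSync

/-- `RecursSync` is antitone in the order. [cite: DafermosLuk2017, §1.2.1] -/
theorem recursSync_anti {k k' : ℕ} (hk : k ≤ k') {𝒟 : VacuumCauchyDevelopment D}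
    (h : RecursSync k' 𝒟) : RecursSync k 𝒟 := by
  obtain ⟨O, N, M, a, mo, τ₀, Ψ, ρ, R, U₀, Ψ₀, h⟩ := h
  exact (h.anti hk).recursSync

end Summit.FinalStateConjecture.FinalStateConjecture.Theorems.ClusterCompleteness

end
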